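import Summits.ResolutionOfSingularities.ResolutionOfSingularities.Theorems.FrobeniusLadderFInjectiveMacaulayficationFCUnguardedDimEq3
import Summits.ResolutionOfSingularities.ResolutionOfSingularities.Theorems.FrobeniusLadderFInjectiveMacaulayficationFCForallExistsRungs
import Summits.ResolutionOfSingularities.ResolutionOfSingularities.Theorems.FrobeniusLadderFInjectiveMacaulayficationFiniteModificationOfBlowupHolds
import HarnessLib

/-!
# FC′ in dimension three from the threefold resolution facts, and the FC′ stub reduced to dimension ≥ 4 (crux `FInjectiveMacaulayfication`)

Support file for crux stmt-ResolutionOfSingularities-15315 (`FrobeniusLadder.FInjectiveMacaulayfication`), chain w45a. [OURS · L1 W4.5a] —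
NOT a statement of any manuscript [claim: Hironaka2017]; AI-written, weaker than expert review; no statement of the manuscript is used;
the named facts enter only as hypotheses (BY NAME). «Variant A» of the dim-3 rung of `FCForallExistsRungs` (res-D-pv-019 AS stub-7,
p545143; text res-L1-w45a-strat-1 `FCRungsSig.lean` v2.4 §A2), kept out of that file until the Cossart–Piltant facts were admissible as
hypotheses by name (res-L1-w45a-plan-1 R13.26 (1) → R13.42); CRUX-PLAN row «`_of_CP` — stub-7, stub-3».

* `fcForallExistsDimEq3_of_fcUnguardedDimEq3` — FC″ ∧ dim 3 ⇒ FC′ ∧ dim 3 (drop the guard; the dimension-three analogue of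
  `GenericFibreReduction.fcForallExists_of_fcUnguarded`);
* `fcForallExistsDimEq3_of_cp` — **`FCForallExistsRungs.FCForallExistsDimEq3` from `CossartPiltant2019General`, `Stacks081R`,
  `CossartPiltant2019Principalization`** (through `FCUnguardedDimEq3.fcUnguardedDimEq3_of_cp`, p546071: the centre is the ideal `𝓛` of the
  one-blowing-up resolution `exists_isBlowup_isRegular_of_dim_three`);
* `fcForallExists_of_dimGe4_cp` — **the FC′ stub of doors v29/v30 (`GenericFibreReduction.FCForallExists`) ⟸ Datta–Murayama ∧
  `CMLocusOpen` ∧ `S2Modification` ∧ the three threefold facts ∧ FC′(dim ≥ 4)**: `FCForallExistsRungs.fcForallExists_of_dimGe4_named` with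
  its S-V hypothesis DISCHARGED by the tree theorem `FiniteModificationOfBlowup.finiteModificationOfBlowupIsBlowup_holds` (p545490) and its
  dim-3 hypothesis by `fcForallExistsDimEq3_of_cp`. So, given the published facts, what remains of FC′ is `CMLocusOpen` (EGA IV 6.11.2 for
  excellent schemes — to be typed), `S2Modification` (in proof, stub-2/stub-7) and the RESIDUAL `FCForallExistsDimGe4`.

All proofs are one-line compositions; no definition, no `sorry`, axioms standard.
-/

-- single-problem summit: the doubled namespace component is forced
set_option linter.dupNamespace false

noncomputable section

open AlgebraicGeometry CategoryTheory Literature.AlgebraicGeometry.Resolution TopologicalSpace IsLocalRing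

namespace Summit.ResolutionOfSingularities.ResolutionOfSingularities.Theorems.FInjectiveMacaulayfication.FCForallExistsDimEq3OfCP

open Summit.ResolutionOfSingularities.ResolutionOfSingularities.Theorems.FInjectiveMacaulayfication

/-- **FC″ ∧ dim 3 ⇒ FC′ ∧ dim 3**: introduce the guard's data `(n, c, hc0, hrad, hgood)` and discard it (dimension-three analogue of
`GenericFibreReduction.fcForallExists_of_fcUnguarded`; identity check of the two dim-3 texts against each other). [folklore] -/
theorem fcForallExistsDimEq3_of_fcUnguardedDimEq3 (h : FCUnguardedDimEq3.FCUnguardedDimEq3) :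
    FCForallExistsRungs.FCForallExistsDimEq3 :=
  fun p hp k _ _ X₁ f₁ hs hft hqc hi hdim hCM η hη _ _ _ _ _ => h p hp k X₁ f₁ hs hft hqc hi hdim hCM η hη

/-- **FC′ HOLDS FOR THREEFOLDS, given CP 2019 Thm. 1.1 (i)(ii), Raynaud–Gruson flattening (Stacks 081R) and CP 2019 Prop. 4.4** — the
«variant A» discharge of the dim-3 rung of `FCForallExistsRungs`: `FCUnguardedDimEq3.fcUnguardedDimEq3_of_cp` (centre `𝓛` of
`exists_isBlowup_isRegular_of_dim_three`, every blowing up along `𝓛` regular hence FULL) followed by the guard drop.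
[cite: CossartPiltant2019, Thm. 1.1 (i)(ii); Prop. 4.4] [cite: StacksProject, Tag 081T; Tag 080B] -/
theorem fcForallExistsDimEq3_of_cp
    (hG : CossartPiltant2019General.{0}) (h081R : Stacks081R.{0}) (hP : CossartPiltant2019Principalization.{0}) :
    FCForallExistsRungs.FCForallExistsDimEq3 :=
  fcForallExistsDimEq3_of_fcUnguardedDimEq3 (FCUnguardedDimEq3.fcUnguardedDimEq3_of_cp hG h081R hP)

/-- **THE FC′ STUB REDUCED TO DIMENSION ≥ 4.** Given Datta–Murayama 2024 Thm. B (route named fact), openness of the Cohen–Macaulay locus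
(`NonFullLocusClosed.CMLocusOpen`), the S₂-ification statement `FCForallExistsDimLe2.S2Modification`, and the threefold facts
`CossartPiltant2019General` / `Stacks081R` / `CossartPiltant2019Principalization` (all BY NAME), the door stub
`GenericFibreReduction.FCForallExists` follows from its dimension-≥-4 residual `FCForallExistsRungs.FCForallExistsDimGe4` ALONE:
`FCForallExistsRungs.fcForallExists_of_dimGe4_named` with `hV := FiniteModificationOfBlowup.finiteModificationOfBlowupIsBlowup_holds`
(S-V is a tree theorem, p545490) and `h3 := fcForallExistsDimEq3_of_cp`. [OURS assembly]
[cite: DattaMurayama2024, Thm. B] [cite: CossartPiltant2019, Thm. 1.1 (i)(ii); Prop. 4.4] [cite: StacksProject, Tag 081T] -/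
theorem fcForallExists_of_dimGe4_cp
    (hDM : Literature.AlgebraicGeometry.Resolution.DattaMurayama2024_fInjectiveLocusOpen.{0})
    (hCMo : NonFullLocusClosed.CMLocusOpen) (hS2 : FCForallExistsDimLe2.S2Modification)
    (hG : CossartPiltant2019General.{0}) (h081R : Stacks081R.{0}) (hP : CossartPiltant2019Principalization.{0})
    (h4 : FCForallExistsRungs.FCForallExistsDimGe4) : GenericFibreReduction.FCForallExists :=
  FCForallExistsRungs.fcForallExists_of_dimGe4_named hDM hCMo hS2
    FiniteModificationOfBlowup.finiteModificationOfBlowupIsBlowup_holds (fcForallExistsDimEq3_of_cp hG h081R hP) h4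

end Summit.ResolutionOfSingularities.ResolutionOfSingularities.Theorems.FInjectiveMacaulayfication.FCForallExistsDimEq3OfCP

end
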